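import Summits.QuantumFields.YangMills.Theorems.ColdStartUniversalityLatticeLangevinAlmostSureErgodic
import HarnessLib

/-!
# Route `ColdStartUniversality` (fixed-cut-off SZZ dynamics): ★★★ ALMOST SURELY, THE EMPIRICAL MEASURE OF A SINGLE COLD-START RUN CONVERGES
# WEAKLY TO THE WILSON–GIBBS MEASURE — `T⁻¹∫₀ᵀ f(U_r) dr → ∫ f dμ_(β')` for ALL continuous `f` simultaneously, a.s.

Helper file (seat `ym-line-csu-p1`, g33; `--supports stmt-QuantumFields-24809`).  File 52 gives, for EACH bounded measurable `G`, the almost-sure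
convergence of the time average `T⁻¹∫₀ᵀ G(U_r) dr → μ_(β')(G)`.  Since `C(SU(2)^E, ℝ)` is separable (compact metrisable configuration space) and time
averages are `1`-Lipschitz in the sup norm, the exceptional null sets of a countable dense family can be united: for EVERY strong solution `U` of
the SU(2) SZZ dynamics from a deterministic start on ANY probability space (every coupling),
* ★★★ `ae_tendsto_timeAverage_forall_continuousMap` — almost surely, for EVERY `f ∈ C(SU(2)^E, ℝ)`,
  `T⁻¹ ∫_(0,T] f(U_r) dr → ∫ f dμ_(β')` — i.e. the empirical (occupation) measures `T⁻¹∫₀ᵀ δ_(U_r) dr` of a single run converge WEAKLY to the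
  Wilson–Gibbs measure `μ_(β')`, almost surely, from every start: the cold-start Langevin simulation is ergodic in the strongest practical sense.
THEOREMS ONLY, no definition, no sorry; [folklore].  HONEST FRAMING: fixed cut-off (no rate uniform in the observable is claimed here; rates for
individual observables are in files 49–56); `UniformColdStartMixing` (24809) is NOT restated; no crux, rung or summit statement is proved; the
Yang–Mills mass gap is NOT proved.
-/

set_option autoImplicit false

noncomputable section

namespace Summit.QuantumFields.YangMills.Theorems.ColdStartUniversality.LiebRobinson

open MeasureTheory ProbabilityTheory Matrix Complex Finset Filter Set Metric
open scoped ComplexConjugate BigOperators Matrix NNReal ENNReal Topology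
open Literature.Probability.Process Literature.MathematicalPhysics.QuantumFieldTheory
open Literature.MathematicalPhysics.QuantumFieldTheory.Balaban1983to89
open Literature.MathematicalPhysics.QuantumLattice (fundamentalRep fundamentalLatticeRep continuous_fundamentalRep fundamentalRep_apply)

variable {L : ℕ} [NeZero L]

/-- ★★★ **Almost-sure weak convergence of the empirical measures of a single run.**  For every strong solution `U` of the SU(2) SZZ dynamics from a
deterministic start on any space: almost surely, for EVERY continuous `f : SU(2)^E → ℝ`, `T⁻¹ ∫_(0,T] f(U_r) dr → ∫ f dμ_(β')` as `T → ∞`. [folklore] -/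
theorem ae_tendsto_timeAverage_forall_continuousMap (L : ℕ) [NeZero L] (β' : ℝ)
    (x : GaugeConfig 3 L (Matrix.specialUnitaryGroup (Fin 2) ℂ))
    {Ω : Type} [MeasurableSpace Ω] {P : Measure Ω} [IsProbabilityMeasure P]
    {W : ℝ≥0 → Ω → (Edge 3 L × NoiseIdx 2 → ℝ)} (hW : IsFlatBrownian W P)
    {U : ℝ≥0 → Ω → GaugeConfig 3 L (Matrix.specialUnitaryGroup (Fin 2) ℂ)} (hU0 : ∀ ω, U 0 ω = x)
    (hU : (latticeLangevinDynamics (fundamentalLatticeRep 2) β').IsSolution (fundamentalRep (Fin 2)) hW.natFiltration P W U) :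
    ∀ᵐ ω ∂P, ∀ f : C(GaugeConfig 3 L (Matrix.specialUnitaryGroup (Fin 2) ℂ), ℝ),
      Tendsto (fun T : ℝ => T⁻¹ * ∫ r in Ioc 0 T, f (U r.toNNReal ω)) atTop
        (𝓝 (∫ z, f z ∂(wilsonMeasure (d := 3) (L := L) (fundamentalRep (Fin 2)) β'))) := by
  classical
  haveI := secondCountableTopology_su2
  haveI := borelSpace_config L
  haveI : IsProbabilityMeasure (wilsonMeasure (d := 3) (L := L) (fundamentalRep (Fin 2)) β') :=
    isProbabilityMeasure_wilsonMeasure (d := 3) (L := L) (fundamentalRep (Fin 2)) (continuous_fundamentalRep (Fin 2)) β'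
  set μ : Measure (GaugeConfig 3 L (Matrix.specialUnitaryGroup (Fin 2) ℂ)) := wilsonMeasure (d := 3) (L := L) (fundamentalRep (Fin 2)) β' with hμ
  -- a countable sup-norm-dense family of continuous functions
  obtain ⟨D, hDc, hDd⟩ := TopologicalSpace.exists_countable_dense C(GaugeConfig 3 L (Matrix.specialUnitaryGroup (Fin 2) ℂ), ℝ)
  -- a jointly measurable realisation from the same start (time integrals of ALL observables agree along it, a.s.)
  obtain ⟨V, hV⟩ := exists_flow_measurable_uncurry L β' hW
  have hae := latticeLangevin_pathwise_unique hW β' x hU0 (hV x).1 hU (hV x).2.1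
  -- a.s. convergence for every member of the countable family
  have hD : ∀ᵐ ω ∂P, ∀ g ∈ D, Tendsto (fun T : ℝ => T⁻¹ * ∫ r in Ioc 0 T, g (U r.toNNReal ω)) atTop (𝓝 (∫ z, g z ∂μ)) := by
    rw [ae_ball_iff hDc]
    intro g _
    exact ae_tendsto_timeAverage_wilson_of_bounded L β' x hW hU0 hU g.continuous.measurable (CG := ‖g‖)
      (fun z => by simpa [Real.norm_eq_abs] using g.norm_coe_le_norm z)
  filter_upwards [hD, hae] with ω hωD hωV f
  -- measurability of `r ↦ f(U_r ω)` along this path (through `V`)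
  have hpath : ∀ r : ℝ, U r.toNNReal ω = V x r.toNNReal ω := fun r => hωV _
  have hVr : Measurable fun r : ℝ => V x r.toNNReal ω := (hV x).2.2.comp (measurable_real_toNNReal.prodMk measurable_const)
  have hmeas : ∀ g : C(GaugeConfig 3 L (Matrix.specialUnitaryGroup (Fin 2) ℂ), ℝ), Measurable fun r : ℝ => g (U r.toNNReal ω) := by
    intro g
    have h1 : (fun r : ℝ => g (U r.toNNReal ω)) = fun r : ℝ => g (V x r.toNNReal ω) := funext fun r => by rw [hpath r]
    rw [h1]; exact g.continuous.measurable.comp hVr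
  -- time averages are `1`-Lipschitz in the sup norm
  have havg : ∀ (g g' : C(GaugeConfig 3 L (Matrix.specialUnitaryGroup (Fin 2) ℂ), ℝ)) (T : ℝ), 0 < T →
      |(T⁻¹ * ∫ r in Ioc 0 T, g (U r.toNNReal ω)) - T⁻¹ * ∫ r in Ioc 0 T, g' (U r.toNNReal ω)| ≤ dist g g' := by
    intro g g' T hT
    haveI : IsFiniteMeasure (volume.restrict (Ioc (0 : ℝ) T)) := isFiniteMeasure_restrict.2 measure_Ioc_lt_top.ne
    have hint : ∀ g : C(GaugeConfig 3 L (Matrix.specialUnitaryGroup (Fin 2) ℂ), ℝ),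
        Integrable (fun r : ℝ => g (U r.toNNReal ω)) (volume.restrict (Ioc 0 T)) := fun g =>
      (integrable_const ‖g‖).mono' (hmeas g).aestronglyMeasurable
        (Eventually.of_forall fun r => by simpa using g.norm_coe_le_norm (U r.toNNReal ω))
    rw [← mul_sub, ← integral_sub (hint g) (hint g'), abs_mul, abs_inv, abs_of_pos hT]
    have hb := norm_setIntegral_le_of_norm_le_const (μ := volume) (s := Ioc 0 T) measure_Ioc_lt_top
      (f := fun r : ℝ => g (U r.toNNReal ω) - g' (U r.toNNReal ω)) (C := dist g g')
      (fun r _ => by rw [← dist_eq_norm]; exact g.dist_apply_le_dist _)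
    rw [Real.norm_eq_abs, Real.volume_real_Ioc_of_le hT.le, sub_zero] at hb
    calc T⁻¹ * |∫ r in Ioc 0 T, (g (U r.toNNReal ω) - g' (U r.toNNReal ω))| ≤ T⁻¹ * (dist g g' * T) :=
          mul_le_mul_of_nonneg_left hb (inv_nonneg.2 hT.le)
      _ = dist g g' := by field_simp
  -- the Gibbs expectations are `1`-Lipschitz in the sup norm
  have hgibbs : ∀ (g g' : C(GaugeConfig 3 L (Matrix.specialUnitaryGroup (Fin 2) ℂ), ℝ)), |(∫ z, g z ∂μ) - ∫ z, g' z ∂μ| ≤ dist g g' := by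
    intro g g'
    have hint : ∀ g : C(GaugeConfig 3 L (Matrix.specialUnitaryGroup (Fin 2) ℂ), ℝ), Integrable (fun z => g z) μ := fun g =>
      (integrable_const ‖g‖).mono' g.continuous.measurable.aestronglyMeasurable (Eventually.of_forall fun z => g.norm_coe_le_norm z)
    rw [← integral_sub (hint g) (hint g')]
    have hb := norm_integral_le_of_norm_le_const (μ := μ) (f := fun z => g z - g' z) (C := dist g g')
      (Eventually.of_forall fun z => by rw [← dist_eq_norm]; exact g.dist_apply_le_dist _)
    simpa [Real.norm_eq_abs] using hb
  -- ε/3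
  rw [Metric.tendsto_atTop]
  intro ε hε
  obtain ⟨g, hgD, hfg⟩ : ∃ g ∈ D, dist f g < ε / 3 := hDd.exists_dist_lt f (by linarith)
  obtain ⟨T₀, hT₀⟩ := (Metric.tendsto_atTop.1 (hωD g hgD)) (ε / 3) (by linarith)
  refine ⟨max T₀ 1, fun T hT => ?_⟩
  have hTpos : 0 < T := lt_of_lt_of_le one_pos ((le_max_right _ _).trans hT)
  have h1 := havg f g T hTpos
  have h2 := hT₀ T ((le_max_left _ _).trans hT)
  have h3 := hgibbs g f
  rw [Real.dist_eq] at h2 ⊢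
  rw [dist_comm] at h3
  calc |(T⁻¹ * ∫ r in Ioc 0 T, f (U r.toNNReal ω)) - ∫ z, f z ∂μ|
      = |((T⁻¹ * ∫ r in Ioc 0 T, f (U r.toNNReal ω)) - T⁻¹ * ∫ r in Ioc 0 T, g (U r.toNNReal ω)) +
          ((T⁻¹ * ∫ r in Ioc 0 T, g (U r.toNNReal ω)) - ∫ z, g z ∂μ) + ((∫ z, g z ∂μ) - ∫ z, f z ∂μ)| := by ring_nf
    _ ≤ |(T⁻¹ * ∫ r in Ioc 0 T, f (U r.toNNReal ω)) - T⁻¹ * ∫ r in Ioc 0 T, g (U r.toNNReal ω)| +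
          |(T⁻¹ * ∫ r in Ioc 0 T, g (U r.toNNReal ω)) - ∫ z, g z ∂μ| + |(∫ z, g z ∂μ) - ∫ z, f z ∂μ| := abs_add_three _ _ _
    _ < ε / 3 + ε / 3 + ε / 3 := by
        have e1 : |(T⁻¹ * ∫ r in Ioc 0 T, f (U r.toNNReal ω)) - T⁻¹ * ∫ r in Ioc 0 T, g (U r.toNNReal ω)| < ε / 3 := lt_of_le_of_lt h1 hfg
        have e3 : |(∫ z, g z ∂μ) - ∫ z, f z ∂μ| < ε / 3 := lt_of_le_of_lt h3 hfg
        linarith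
    _ = ε := by ring
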